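import Summits.CriticalPhenomena.PercolationContinuityZ3.Theorems.PercNearOneGluingNoHeavyLowerTailFatMinorityAnchoredRelay
import HarnessLib

/-!
# `NoHeavyLowerTail` (stmt-CriticalPhenomena-4575), line fat-minority-linear — the ELEMENTARY COVER
# behind the anchored / dominant-relay classes (a correction of emphasis)

Relay set `A`, observer `o`, `N = #{a ∈ A : o ↔ a}`, `η ≥ max P(a ↮ a')`.  For ANY relay `a₀ ∈ A`,

  `{0 < N, 2N ≤ |A|} ⊆ ({o ↔ A} ∩ {o ↮ a₀}) ∪ {a₀ lies in a cluster with ≤ |A|/2 relays}`,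

so `P(0 < N ∧ 2N ≤ |A|) ≤ P(o ↔ A, o ↮ a₀) + 2η` (`fatMinorityZero_le_reachNotConn_add`): the
fat-minority stub at `d₀ = 0` is bounded by LINEAR GLUING AT A SINGLE RELAY plus `2η`, pointwise in
the graph (sharper than the Markov route `fatMinorityLinear_of_linearGluing`, which averages over
all relays).  Consequently the anchored-relay hypothesis of `…FatMinorityAnchoredRelay` /
`…FatMinorityDominantRelay` (`P(o ↔ A, o ↮ a₀) ≤ θ P(o ↮ a₀)`, i.e. gluing at `a₀` with no `η`-term)
yields the stub by two lines of arithmetic (`fatMinority_anchoredRelay_elementary`, better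
constant) — those classes are NOT independent progress on the crux, and van den Berg–Häggström–Kahn
Thm. 1.4 contributes there only the factor `P(Maj_{a₀} | o ↮ a₀) ≥ 1 − 2η/P(o ↮ a₀)`.  Recorded so
that the line's class map is read correctly: closed classes = bounded `|A|`, no-majority off `o`,
star-attached observers, single-relay gluing; residual = observers for which `P(o ↔ A, o ↮ a)` is
large compared with `P(o ↮ A) + η` for EVERY relay `a` (the moving-pocket / hub regime).
-/

noncomputable section

namespace Summit.CriticalPhenomena.PercolationContinuityZ3.Theorems

open MeasureTheory Set Literature.Probability.LatticeModels Literature.Probability.Percolation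
open scoped Classical BigOperators

/-! ## The elementary cover

For ANY relay `a₀ ∈ A` the inclusion `{0 < N, 2N ≤ |A|} ⊆ ({o ↔ A} ∩ {o ↮ a₀}) ∪ Maj_{a₀}ᶜ`
(an observer in the minority either misses `a₀`, or shares its minority cluster with `a₀`) gives
`P(0 < N ∧ 2N ≤ |A|) ≤ P(o ↔ A, o ↮ a₀) + 2η` (`fatMinorityZero_le_reachNotConn_add`).  Under the
anchoring hypothesis `P(o ↔ A, o ↮ a₀) ≤ θ P(o ↮ a₀)` one has `(1−θ) P(o ↔ A, o ↮ a₀) ≤ θ P(o ↮ A)`,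
so `fatMinority_anchoredRelay` follows WITHOUT BHK and with a better constant
(`fatMinority_anchoredRelay_elementary`).  Hence the anchored / dominant classes are exactly "linear
gluing assumed at the single relay `a₀` with no `η`-term" and must not be over-read as progress on
the crux; van den Berg–Häggström–Kahn's Thm. 1.4 contributes here only the factor
`P(Maj_{a₀} | o ↮ a₀)`, which is `≥ 1 − 2η / P(o ↮ a₀)`.  The correlation inequalities
`reachSet_openConn_negCorr`, `reachSet_majority_negCorr` stay available as tools. -/

/-- **Elementary cover.** For any relay `a₀ ∈ A` with `P(a₀ ↮ a) ≤ η` on `A`: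
`P(0 < N ∧ 2N ≤ |A|) ≤ P({o ↔ A} ∩ {o ↮ a₀}) + 2η`. [folklore] -/
theorem fatMinorityZero_le_reachNotConn_add {n : ℕ} (w : Sym2 (Fin n) → unitInterval)
    (A : Finset (Fin n)) (o a₀ : Fin n) (η : ℝ) (ha₀ : a₀ ∈ A)
    (hpair : ∀ a ∈ A, (prodBernoulli w).real (openConn a₀ a : Set (BondConfig (Fin n)))ᶜ ≤ η) :
    (prodBernoulli w).real {ω : BondConfig (Fin n) |
        0 < (A.filter fun a => ω ∈ openConn o a).card ∧
          2 * (A.filter fun a => ω ∈ openConn o a).card ≤ A.card} ≤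
      (prodBernoulli w).real ((⋃ a' ∈ A, (openConn o a' : Set (BondConfig (Fin n)))) ∩
          (openConn o a₀ : Set (BondConfig (Fin n)))ᶜ) + 2 * η := by
  have hmeas : ∀ s : Set (BondConfig (Fin n)), MeasurableSet s :=
    fun _ => MeasurableSet.of_discrete
  set P := prodBernoulli w with hP
  set Majc : Set (BondConfig (Fin n)) :=
    {ω | 2 * (A.filter fun a => ω ∈ openConn a₀ a).card ≤ A.card} with hMajc
  set m : ℝ := (A.card : ℝ) with hm
  have hmpos : 0 < m := by rw [hm]; exact_mod_cast Finset.card_pos.2 ⟨a₀, ha₀⟩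
  -- `a₀` in the minority costs `2η`
  have hMajc_le : P.real Majc ≤ 2 * η := by
    have hc := halfLeSevenForms_mul_measureReal_le_sum_inter P A
      (fun a => (openConn a₀ a : Set (BondConfig (Fin n)))ᶜ) (fun _ _ => hmeas _) (hmeas Majc)
      (m / 2) ?_
    · have hsum : ∑ a ∈ A, P.real (Majc ∩ (openConn a₀ a : Set (BondConfig (Fin n)))ᶜ) ≤ m * η := by
        calc ∑ a ∈ A, P.real (Majc ∩ (openConn a₀ a : Set (BondConfig (Fin n)))ᶜ)
            ≤ ∑ a ∈ A, η := Finset.sum_le_sum fun a ha =>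
              (measureReal_mono Set.inter_subset_right (measure_ne_top _ _)).trans (hpair a ha)
          _ = m * η := by rw [Finset.sum_const, nsmul_eq_mul, hm]
      have h2 : m / 2 * P.real Majc ≤ m / 2 * (2 * η) := by
        calc m / 2 * P.real Majc ≤ m * η := hc.trans hsum
          _ = m / 2 * (2 * η) := by ring
      exact le_of_mul_le_mul_left h2 (by positivity)
    intro ω hω
    have hind : ∀ a ∈ A,
        ((openConn a₀ a : Set (BondConfig (Fin n)))ᶜ).indicator (fun _ => (1 : ℝ)) ω =
          if ¬ ω ∈ (openConn a₀ a : Set (BondConfig (Fin n))) then (1 : ℝ) else 0 := by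
      intro a _
      by_cases h' : ω ∈ (openConn a₀ a : Set (BondConfig (Fin n)))
      · rw [if_neg (not_not.2 h'), Set.indicator_of_notMem (Set.notMem_compl_iff.2 h')]
      · rw [if_pos h', Set.indicator_of_mem (show ω ∈ (openConn a₀ a : Set (BondConfig (Fin n)))ᶜ
          from h')]
    rw [Finset.sum_congr rfl hind, Finset.sum_boole]
    have hω' : 2 * (A.filter fun a => ω ∈ openConn a₀ a).card ≤ A.card := hω
    have hsplit := Finset.card_filter_add_card_filter_not (s := A)
      (fun a => ω ∈ (openConn a₀ a : Set (BondConfig (Fin n))))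
    have hcast : ((A.filter fun a => ω ∈ (openConn a₀ a : Set (BondConfig (Fin n)))).card : ℝ) +
        ((A.filter fun a => ¬ ω ∈ (openConn a₀ a : Set (BondConfig (Fin n)))).card : ℝ) = m := by
      rw [hm]; exact_mod_cast hsplit
    have hle : 2 * ((A.filter fun a => ω ∈ (openConn a₀ a : Set (BondConfig (Fin n)))).card : ℝ) ≤ m := by
      rw [hm]; exact_mod_cast hω'
    linarith
  -- cover
  have hcov : {ω : BondConfig (Fin n) |
        0 < (A.filter fun a => ω ∈ openConn o a).card ∧
          2 * (A.filter fun a => ω ∈ openConn o a).card ≤ A.card} ⊆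
      ((⋃ a' ∈ A, (openConn o a' : Set (BondConfig (Fin n)))) ∩
          (openConn o a₀ : Set (BondConfig (Fin n)))ᶜ) ∪ Majc := by
    rintro ω ⟨hpos, hmin⟩
    by_cases hoa₀ : ω ∈ (openConn o a₀ : Set (BondConfig (Fin n)))
    · right
      change 2 * (A.filter fun a => ω ∈ openConn a₀ a).card ≤ A.card
      have hsub : (A.filter fun a => ω ∈ openConn a₀ a) ⊆ (A.filter fun a => ω ∈ openConn o a) := by
        intro a ha
        rw [Finset.mem_filter] at ha ⊢
        have h1 : (openGraph ω).Reachable o a₀ := hoa₀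
        have h2 : (openGraph ω).Reachable a₀ a := ha.2
        exact ⟨ha.1, h1.trans h2⟩
      have := Finset.card_le_card hsub
      omega
    · left
      obtain ⟨a, ha⟩ := Finset.card_pos.1 hpos
      rw [Finset.mem_filter] at ha
      exact ⟨Set.mem_biUnion (Finset.mem_coe.2 ha.1) ha.2, hoa₀⟩
  calc P.real {ω : BondConfig (Fin n) |
          0 < (A.filter fun a => ω ∈ openConn o a).card ∧
            2 * (A.filter fun a => ω ∈ openConn o a).card ≤ A.card}
      ≤ P.real (((⋃ a' ∈ A, (openConn o a' : Set (BondConfig (Fin n)))) ∩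
          (openConn o a₀ : Set (BondConfig (Fin n)))ᶜ) ∪ Majc) :=
        measureReal_mono hcov (measure_ne_top _ _)
    _ ≤ P.real ((⋃ a' ∈ A, (openConn o a' : Set (BondConfig (Fin n)))) ∩
          (openConn o a₀ : Set (BondConfig (Fin n)))ᶜ) + P.real Majc := measureReal_union_le _ _
    _ ≤ _ := by linarith

/-- **The anchored class, elementary proof and better constant.**  If
`P(o ↔ A, o ↮ a₀) ≤ θ · P(o ↮ a₀)` (`a₀ ∈ A`, `0 ≤ θ`) then
`(1 − θ) · P(0 < N ∧ 2N ≤ |A|) ≤ θ · P(o ↮ A) + 2η`: from the elementary cover and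
`P(o ↮ a₀) = P(o ↮ A) + P(o ↔ A, o ↮ a₀)`.  No correlation inequality is needed. [folklore] -/
theorem fatMinority_anchoredRelay_elementary {n : ℕ} (w : Sym2 (Fin n) → unitInterval)
    (A : Finset (Fin n)) (o a₀ : Fin n) (η θ : ℝ) (hθ : 0 ≤ θ) (ha₀ : a₀ ∈ A)
    (hdom : (prodBernoulli w).real ((openConn o a₀ : Set (BondConfig (Fin n)))ᶜ ∩
        (⋃ a' ∈ A, (openConn o a' : Set (BondConfig (Fin n))))) ≤
      θ * (prodBernoulli w).real (openConn o a₀ : Set (BondConfig (Fin n)))ᶜ)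
    (hpair : ∀ a ∈ A, ∀ a' ∈ A, (prodBernoulli w).real (openConn a a' : Set (BondConfig (Fin n)))ᶜ ≤ η) :
    (1 - θ) * (prodBernoulli w).real {ω : BondConfig (Fin n) |
        0 < (A.filter fun a => ω ∈ openConn o a).card ∧
          2 * (A.filter fun a => ω ∈ openConn o a).card ≤ A.card} ≤
      θ * (prodBernoulli w).real (⋃ a' ∈ A, (openConn o a' : Set (BondConfig (Fin n))))ᶜ + 2 * η := by
  have hmeas : ∀ s : Set (BondConfig (Fin n)), MeasurableSet s :=
    fun _ => MeasurableSet.of_discrete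
  set P := prodBernoulli w with hP
  set D : Set (BondConfig (Fin n)) := (openConn o a₀ : Set (BondConfig (Fin n)))ᶜ with hD
  set U : Set (BondConfig (Fin n)) := ⋃ a' ∈ A, (openConn o a' : Set (BondConfig (Fin n))) with hU
  have hη0 : 0 ≤ η := le_trans measureReal_nonneg (hpair a₀ ha₀ a₀ ha₀)
  have hcover := fatMinorityZero_le_reachNotConn_add w A o a₀ η ha₀ (fun a ha => hpair a₀ ha₀ a ha)
  have hUc_sub : Uᶜ ⊆ D := by
    intro ω hω hoa₀
    exact hω (Set.mem_biUnion (Finset.mem_coe.2 ha₀) hoa₀)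
  -- `μ(D) = μ(Uᶜ) + μ(D ∩ U)`
  have hDeq : D = (D ∩ U) ∪ Uᶜ := by
    ext ω
    constructor
    · intro hω
      by_cases hωU : ω ∈ U
      · exact Or.inl ⟨hω, hωU⟩
      · exact Or.inr hωU
    · rintro (hω | hω)
      · exact hω.1
      · exact hUc_sub hω
  have hdisj : Disjoint (D ∩ U) Uᶜ := by
    rw [Set.disjoint_left]
    rintro ω ⟨-, hωU⟩ hωUc
    exact hωUc hωU
  have hsum := measureReal_union (μ := P) hdisj (hmeas Uᶜ)
  rw [← hDeq] at hsum
  have hUD : P.real (U ∩ D) = P.real (D ∩ U) := by rw [Set.inter_comm]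
  have hF0 : 0 ≤ P.real {ω : BondConfig (Fin n) |
      0 < (A.filter fun a => ω ∈ openConn o a).card ∧
        2 * (A.filter fun a => ω ∈ openConn o a).card ≤ A.card} := measureReal_nonneg
  have hUc0 : 0 ≤ P.real Uᶜ := measureReal_nonneg
  have hx0 : 0 ≤ P.real (D ∩ U) := measureReal_nonneg
  -- `(1 − θ) μ(D ∩ U) ≤ θ μ(Uᶜ)`
  have h1 : (1 - θ) * P.real (D ∩ U) ≤ θ * P.real Uᶜ := by nlinarith [hdom, hsum]
  rcases le_or_gt θ 1 with hθ1 | hθ1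
  · have h2 : (1 - θ) * P.real {ω : BondConfig (Fin n) |
        0 < (A.filter fun a => ω ∈ openConn o a).card ∧
          2 * (A.filter fun a => ω ∈ openConn o a).card ≤ A.card} ≤
        (1 - θ) * (P.real (U ∩ D) + 2 * η) :=
      mul_le_mul_of_nonneg_left hcover (sub_nonneg.2 hθ1)
    rw [hUD] at h2
    nlinarith [h1, h2, sub_nonneg.2 hθ1]
  · have h2 : (1 - θ) * P.real {ω : BondConfig (Fin n) |
        0 < (A.filter fun a => ω ∈ openConn o a).card ∧
          2 * (A.filter fun a => ω ∈ openConn o a).card ≤ A.card} ≤ 0 :=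
      mul_nonpos_of_nonpos_of_nonneg (by linarith) hF0
    nlinarith [h2, mul_nonneg hθ hUc0]

end Summit.CriticalPhenomena.PercolationContinuityZ3.Theorems

end
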